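import Summits.BirchSwinnertonDyer.BirchSwinnertonDyer.Theorems.ClassRecordThreeRegCertKernelUniformSeries
import HarnessLib

/-!
# Route `ClassRecordThree`, crux `SchneiderAtThree` (item 19106): the two Iwasawa logarithms UNEXPANDED, and the unit part
# of `log_Ŵ(z(Q))` at depth `K ≥ 2`, for the precision-parametrised deep REG3CERT kernel checker
# (cell `bsd-stepL`, seat `bsd-stepL-reg3-eng` g4; `--supports stmt-BirchSwinnertonDyer-19106`)

HONEST FRAMING: BSD is not proved by any of this; nothing here closes the crux; Schneider's non-degeneracy conjecture
(barrier `PAdicHeightNondegeneracy`) is asserted NOWHERE; every application is ONE curve.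

* §4 `log₃ A = log₃ B` with `A ≡ Pα`, `B ≡ Pβ` to relative precision `3⁻ᴺ` (`α, β` units) forces `A² = B²`
  (multiplicativity `padicLog_mul_holds` + `‖L(y) + (1 − y)‖ ≤ ‖1 − y‖²` on principal units), hence `3^N ∣ β² − α²`:
  the height certificate becomes the single integer fact `3^N ∤ υ² − e'⁴` — no logarithmic series is evaluated;
* §5 `‖log_Ŵ(z)/3ᴷ − λ‖ ≤ 3⁻ᴺ` (`N ≤ 4K`) from one integer congruence modulo `3^{N+1}` (§1 of `…UniformSeries`).

Theorems only (0 defs, 0 facts). References: [Iwasawa1972PadicL] §4.4; [SilvermanAEC2009] IV.5.5, IV.6.4.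
-/

open scoped Classical

open PowerSeries WeierstrassCurve Literature.NumberTheory.EllipticCurves
  Literature.NumberTheory.EllipticCurves.Rank1Residual
  Literature.NumberTheory.EllipticCurves.SteinWuthrich2013
  Summit.BirchSwinnertonDyer.Rank1Residual
  Summit.BirchSwinnertonDyer.Rank1Residual.X11b
  Summit.BirchSwinnertonDyer.Rank1Residual.X11b.RegMult.Rung62310y1

namespace Summit.BirchSwinnertonDyer.Rank1Residual.X11b.RegMult.KernelCert

/-! ### §0 Plumbing -/

/-- `‖3^k‖₃ = 1/3^k`. [folklore] -/
private theorem norm_three_pow (k : ℕ) : ‖(3 : ℚ_[3]) ^ k‖ = 1 / (3 : ℝ) ^ k := by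
  rw [norm_pow, show (3 : ℚ_[3]) = ((3 : ℕ) : ℚ_[3]) by norm_cast, Padic.norm_p]; simp

/-- `1/3^l ≤ 1/3^k` for `k ≤ l`. [folklore] -/
private theorem third_pow_le {k l : ℕ} (h : k ≤ l) : 1 / (3 : ℝ) ^ l ≤ 1 / (3 : ℝ) ^ k :=
  one_div_le_one_div_of_le (by positivity) (pow_le_pow_right₀ (by norm_num) h)

/-- `‖(2 : ℚ₃)⁻¹‖ = 1`. [folklore] -/
private theorem norm_inv_two₇ : ‖(2 : ℚ_[3])⁻¹‖ = 1 := by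
  rw [norm_inv, show (2 : ℚ_[3]) = ((2 : ℤ) : ℚ_[3]) by norm_cast, norm_intCast_eq_one_of_not_dvd (by decide),
    inv_one]

/-- `3^n ∣ k ⇒ ‖(k : ℚ₃)‖ ≤ 3^{−n}` in the `zpow` form of `Padic.norm_int_le_pow_iff_dvd`. [folklore] -/
private theorem pow_dvd_of_norm_le {k : ℤ} {n : ℕ} (h : ‖(k : ℚ_[3])‖ ≤ 1 / (3 : ℝ) ^ n) : (3 : ℤ) ^ n ∣ k := by
  have h' : ‖(k : ℚ_[3])‖ ≤ ((3 : ℕ) : ℝ) ^ (-(n : ℤ)) := by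
    rw [zpow_neg, zpow_natCast, ← one_div]; exact_mod_cast h
  have := (Padic.norm_int_le_pow_iff_dvd (p := 3) k n).mp h'
  exact_mod_cast this

/-! ### §4 The two Iwasawa logarithms, unexpanded: equal logs at equal valuation force equal squares -/

/-- **Equal Iwasawa logarithms with certified unit parts are impossible.** Let `P ≠ 0` in `ℚ₃`, `α, β` integers prime
to `3`, `‖A − Pα‖ ≤ ‖P‖·3⁻ᴺ`, `‖B − Pβ‖ ≤ ‖P‖·3⁻ᴺ` (`N ≥ 1`). If `log₃ A = log₃ B` then (multiplicativity,
`padicLog_mul_holds`) `log₃ (A/B) = 0` with `A/B` a unit, so `L((A/B)²) = 0` for the principal-unit series `L`, whose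
first-order estimate `‖L(y) + (1 − y)‖ ≤ ‖1 − y‖²` (`norm_padicLogSeries_add_le`) forces `(A/B)² = 1`, i.e. `A² = B²`,
whence `3^N ∣ β² − α²`. So **`3^N ∤ β² − α² ⇒ log₃ A ≠ log₃ B`** — no logarithmic series is evaluated.
[cite: Iwasawa1972PadicL, §4.4] -/
theorem padicLog_ne_padicLog_of_unitResidue {A B P : ℚ_[3]} {α β : ℤ} {N : ℕ} (hP : P ≠ 0)
    (h3α : ¬ (3 : ℤ) ∣ α) (h3β : ¬ (3 : ℤ) ∣ β) (hN : 1 ≤ N)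
    (hA : ‖A - P * α‖ ≤ ‖P‖ / (3 : ℝ) ^ N) (hB : ‖B - P * β‖ ≤ ‖P‖ / (3 : ℝ) ^ N)
    (hcert : ¬ (3 : ℤ) ^ N ∣ β ^ 2 - α ^ 2) : padicLog 3 A ≠ padicLog 3 B := by
  have hαn : ‖(α : ℚ_[3])‖ = 1 := norm_intCast_eq_one_of_not_dvd h3α
  have hβn : ‖(β : ℚ_[3])‖ = 1 := norm_intCast_eq_one_of_not_dvd h3β
  have hPpos : 0 < ‖P‖ := norm_pos_iff.mpr hP
  have hN3 : ‖P‖ / (3 : ℝ) ^ N < ‖P‖ := by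
    rw [div_lt_iff₀ (by positivity)]
    have : (1 : ℝ) < (3 : ℝ) ^ N := one_lt_pow₀ (by norm_num) (by omega)
    nlinarith
  -- `‖A‖ = ‖B‖ = ‖P‖`
  have hAn : ‖A‖ = ‖P‖ := by
    have h : ‖A - P * α‖ < ‖P * (α : ℚ_[3])‖ := by rw [norm_mul, hαn, mul_one]; exact hA.trans_lt hN3
    rw [Padic.norm_eq_of_norm_sub_lt_right h, norm_mul, hαn, mul_one]
  have hBn : ‖B‖ = ‖P‖ := by
    have h : ‖B - P * β‖ < ‖P * (β : ℚ_[3])‖ := by rw [norm_mul, hβn, mul_one]; exact hB.trans_lt hN3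
    rw [Padic.norm_eq_of_norm_sub_lt_right h, norm_mul, hβn, mul_one]
  have hA0 : A ≠ 0 := by intro h; rw [h, norm_zero] at hAn; exact hPpos.ne hAn
  have hB0 : B ≠ 0 := by intro h; rw [h, norm_zero] at hBn; exact hPpos.ne hBn
  -- the unit parts `A/P`, `B/P` are within `3⁻ᴺ` of `α`, `β`
  have hA' : ‖A * P⁻¹ - α‖ ≤ 1 / (3 : ℝ) ^ N := by
    have : A * P⁻¹ - α = (A - P * α) * P⁻¹ := by field_simp
    rw [this, norm_mul, norm_inv]
    calc ‖A - P * α‖ * ‖P‖⁻¹ ≤ ‖P‖ / (3 : ℝ) ^ N * ‖P‖⁻¹ := by gcongr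
      _ = 1 / (3 : ℝ) ^ N := by field_simp
  have hB' : ‖B * P⁻¹ - β‖ ≤ 1 / (3 : ℝ) ^ N := by
    have : B * P⁻¹ - β = (B - P * β) * P⁻¹ := by field_simp
    rw [this, norm_mul, norm_inv]
    calc ‖B - P * β‖ * ‖P‖⁻¹ ≤ ‖P‖ / (3 : ℝ) ^ N * ‖P‖⁻¹ := by gcongr
      _ = 1 / (3 : ℝ) ^ N := by field_simp
  intro hlog
  -- `ξ = A/B` is a unit with `log₃ ξ = 0`
  set ξ : ℚ_[3] := A * B⁻¹ with hξ
  have hξn : ‖ξ‖ = 1 := by rw [hξ, norm_mul, norm_inv, hAn, hBn]; field_simp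
  have hξ0 : ξ ≠ 0 := by intro h; rw [h, norm_zero] at hξn; exact zero_ne_one hξn
  have hlog1 : padicLog 3 (1 : ℚ_[3]) = 0 :=
    (padicLog_eq_zero_iff_holds 3 one_ne_zero).mpr ⟨0, 1, one_pos, by simp⟩
  have hlogBinv : padicLog 3 B⁻¹ = -padicLog 3 B := by
    have h := padicLog_mul_holds 3 hB0 (inv_ne_zero hB0)
    rw [mul_inv_cancel₀ hB0, hlog1] at h
    linear_combination -h
  have hlogξ : padicLog 3 ξ = 0 := by
    rw [hξ, padicLog_mul_holds 3 hA0 (inv_ne_zero hB0), hlogBinv, hlog, add_neg_cancel]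
  -- `log₃ ξ = 2⁻¹ L(ξ²)` at valuation `0`
  have hval : ξ.valuation = 0 := by
    refine valuation_eq_of_norm_eq hξ0 ?_
    rw [hξn]; simp
  have hL : padicLogSeries 3 (ξ ^ 2) = 0 := by
    have h := padicLog_of_ne_zero hξ0
    rw [hval, neg_zero, zpow_zero, mul_one, show (3 : ℕ) - 1 = 2 from rfl, hlogξ] at h
    have h2 : ((3 : ℕ) : ℚ_[3]) - 1 = 2 := by norm_num
    rw [h2] at h
    have h20 : (2 : ℚ_[3])⁻¹ ≠ 0 := inv_ne_zero two_ne_zero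
    rcases mul_eq_zero.mp h.symm with h' | h'
    · exact absurd h' h20
    · exact h'
  -- `‖1 − ξ²‖ < 1`, and `L(ξ²) = 0` forces `ξ² = 1`
  have h1ξ : ‖1 - ξ ^ 2‖ < 1 := by
    have := norm_one_sub_pow_sub_one_lt (p := 3) hξn
    rwa [show (3 : ℕ) - 1 = 2 from rfl] at this
  have hξ2 : ξ ^ 2 = 1 := by
    by_contra hne
    have ht0 : 1 - ξ ^ 2 ≠ 0 := sub_ne_zero.mpr (Ne.symm hne)
    have htpos : 0 < ‖1 - ξ ^ 2‖ := norm_pos_iff.mpr ht0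
    have hest := norm_padicLogSeries_add_le (p := 3) h1ξ
    rw [hL, zero_add, norm_inv_two₇, mul_one] at hest
    have : ‖1 - ξ ^ 2‖ < ‖1 - ξ ^ 2‖ := by
      calc ‖1 - ξ ^ 2‖ ≤ ‖1 - ξ ^ 2‖ ^ 2 := hest
        _ = ‖1 - ξ ^ 2‖ * ‖1 - ξ ^ 2‖ := sq _
        _ < ‖1 - ξ ^ 2‖ * 1 := by gcongr
        _ = ‖1 - ξ ^ 2‖ := mul_one _
    exact lt_irrefl _ this
  -- hence `(A/P)² = (B/P)²` and `3^N ∣ α² − β²`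
  have hsq : (A * P⁻¹) ^ 2 = (B * P⁻¹) ^ 2 := by
    have hAB : A ^ 2 = B ^ 2 := by
      have h1 : A = ξ * B := by rw [hξ]; field_simp
      rw [h1, mul_pow, hξ2, one_mul]
    rw [mul_pow, mul_pow, hAB]
  have hdiff : ‖(((α ^ 2 - β ^ 2 : ℤ)) : ℚ_[3])‖ ≤ 1 / (3 : ℝ) ^ N := by
    have hid : (((α ^ 2 - β ^ 2 : ℤ)) : ℚ_[3]) =
        ((α : ℚ_[3]) - A * P⁻¹) * ((α : ℚ_[3]) + A * P⁻¹) + (B * P⁻¹ - β) * (B * P⁻¹ + β) := by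
      push_cast; linear_combination hsq
    rw [hid]
    have hαA : ‖(α : ℚ_[3]) + A * P⁻¹‖ ≤ 1 := by
      have : (α : ℚ_[3]) + A * P⁻¹ = (A * P⁻¹ - α) + 2 * α := by ring
      rw [this]
      refine (IsUltrametricDist.norm_add_le_max _ _).trans (max_le (hA'.trans ?_) ?_)
      · exact (third_pow_le (Nat.zero_le N)).trans (by norm_num)
      · rw [norm_mul, hαn, mul_one, show (2 : ℚ_[3]) = ((2 : ℤ) : ℚ_[3]) by norm_cast]
        exact Padic.norm_int_le_one _
    have hβB : ‖B * P⁻¹ + β‖ ≤ 1 := by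
      have : B * P⁻¹ + (β : ℚ_[3]) = (B * P⁻¹ - β) + 2 * β := by ring
      rw [this]
      refine (IsUltrametricDist.norm_add_le_max _ _).trans (max_le (hB'.trans ?_) ?_)
      · exact (third_pow_le (Nat.zero_le N)).trans (by norm_num)
      · rw [norm_mul, hβn, mul_one, show (2 : ℚ_[3]) = ((2 : ℤ) : ℚ_[3]) by norm_cast]
        exact Padic.norm_int_le_one _
    refine (IsUltrametricDist.norm_add_le_max _ _).trans (max_le ?_ ?_)
    · rw [norm_mul, ← norm_neg, neg_sub]
      calc ‖A * P⁻¹ - α‖ * ‖(α : ℚ_[3]) + A * P⁻¹‖ ≤ 1 / (3 : ℝ) ^ N * 1 := by gcongr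
        _ = 1 / (3 : ℝ) ^ N := mul_one _
    · rw [norm_mul]
      calc ‖B * P⁻¹ - β‖ * ‖B * P⁻¹ + β‖ ≤ 1 / (3 : ℝ) ^ N * 1 := by gcongr
        _ = 1 / (3 : ℝ) ^ N := mul_one _
  have hdvd : (3 : ℤ) ^ N ∣ α ^ 2 - β ^ 2 := pow_dvd_of_norm_le hdiff
  exact hcert (by rw [show β ^ 2 - α ^ 2 = -(α ^ 2 - β ^ 2) by ring]; exact hdvd.neg_right)

/-! ### §5 The unit part of the formal logarithm at depth `K` -/

/-- **The unit part of `log_Ŵ(z(Q))` at depth `K ≥ 2`.** For `V/ℚ₃` `3`-integral with `a₁, a₂, a₃` the given integers and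
`z = −a·3ᴷe'/b` (`3 ∤ a, b, e'`): if `N ≤ 4K` and
`3^{N+1} ∣ −12(ae')b³ + 6a₁3ᴷ(ae')²b² − 4(a₁²+a₂)3^{2K}(ae')³b + 3(a₁³+2a₁a₂+2a₃)3^{3K}(ae')⁴ − 12λb⁴`, then
`‖log_Ŵ(z)/3ᴷ − λ‖ ≤ 3⁻ᴺ` and `‖log_Ŵ(z)‖ = 3⁻ᴷ` (§1: the quartic truncation is exact to `‖z‖⁵ = 3^{−5K}`).
[cite: SilvermanAEC2009, IV.5.5, IV.6.4] -/
theorem norm_formalLog_unitPart_sub_le (V : WeierstrassCurve ℚ_[3]) [V.IsIntegral ℤ_[3]] {a₁ a₂ a₃ : ℤ}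
    (ha1 : V.a₁ = a₁) (ha2 : V.a₂ = a₂) (ha3 : V.a₃ = a₃) {a b lam : ℤ} {e' K N : ℕ} (hK : 2 ≤ K) (hNK : N ≤ 4 * K)
    (h3a : ¬ (3 : ℤ) ∣ a) (h3b : ¬ (3 : ℤ) ∣ b) (h3e' : ¬ (3 : ℤ) ∣ e')
    (hlam : (3 : ℤ) ^ (N + 1) ∣ -12 * (a * e') * b ^ 3 + 6 * a₁ * 3 ^ K * (a * e') ^ 2 * b ^ 2 -
      4 * (a₁ ^ 2 + a₂) * 3 ^ (2 * K) * (a * e') ^ 3 * b + 3 * (a₁ ^ 3 + 2 * a₁ * a₂ + 2 * a₃) * 3 ^ (3 * K) * (a * e') ^ 4 -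
      12 * lam * b ^ 4) :
    ‖V.padicFormalLog (-((a : ℚ_[3]) * ((3 ^ K * e' : ℕ) : ℚ_[3])) / (b : ℚ_[3])) * ((3 : ℚ_[3]) ^ K)⁻¹ - lam‖ ≤
        1 / (3 : ℝ) ^ N ∧
      ‖V.padicFormalLog (-((a : ℚ_[3]) * ((3 ^ K * e' : ℕ) : ℚ_[3])) / (b : ℚ_[3]))‖ = 1 / (3 : ℝ) ^ K := by
  have han : ‖(a : ℚ_[3])‖ = 1 := norm_intCast_eq_one_of_not_dvd h3a
  have hbn : ‖(b : ℚ_[3])‖ = 1 := norm_intCast_eq_one_of_not_dvd h3b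
  have he'n : ‖(e' : ℚ_[3])‖ = 1 := by
    have := norm_intCast_eq_one_of_not_dvd h3e'; push_cast at this; exact this
  have hb0 : (b : ℚ_[3]) ≠ 0 := by intro h; rw [h, norm_zero] at hbn; exact zero_ne_one hbn
  set P' : ℚ_[3] := (3 : ℚ_[3]) ^ K with hP'
  have hP'n : ‖P'‖ = 1 / (3 : ℝ) ^ K := norm_three_pow K
  have hP'0 : P' ≠ 0 := pow_ne_zero K (by norm_num)
  set z : ℚ_[3] := -((a : ℚ_[3]) * ((3 ^ K * e' : ℕ) : ℚ_[3])) / (b : ℚ_[3]) with hz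
  have hzP : z = -(P' * ((a : ℚ_[3]) * (e' : ℚ_[3]))) / (b : ℚ_[3]) := by rw [hz, hP']; push_cast; ring
  have hρ : ‖z‖ = 1 / (3 : ℝ) ^ K := by
    rw [hzP, norm_div, norm_neg, norm_mul, norm_mul, hP'n, han, he'n, hbn]; simp
  have hρ9 : ‖z‖ ≤ 1 / 9 := by
    rw [hρ]; calc 1 / (3 : ℝ) ^ K ≤ 1 / (3 : ℝ) ^ 2 := third_pow_le hK
      _ = 1 / 9 := by norm_num
  set L := V.padicFormalLog z with hLdef
  -- the quartic truncation
  set L4 : ℚ_[3] := z + (2 : ℚ_[3])⁻¹ * V.a₁ * z ^ 2 + (3 : ℚ_[3])⁻¹ * (V.a₁ ^ 2 + V.a₂) * z ^ 3 +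
      (4 : ℚ_[3])⁻¹ * (V.a₁ ^ 3 + 2 * V.a₁ * V.a₂ + 2 * V.a₃) * z ^ 4 with hL4
  have hLL4 : ‖L - L4‖ ≤ ‖z‖ ^ 5 := norm_padicFormalLog_sub_quartic_le_deep V hρ9
  -- `‖(L − L4)/3^K‖ ≤ 3^{−4K} ≤ 3^{−N}`
  have h1 : ‖(L - L4) * P'⁻¹‖ ≤ 1 / (3 : ℝ) ^ N := by
    rw [norm_mul, norm_inv, hP'n]
    calc ‖L - L4‖ * (1 / (3 : ℝ) ^ K)⁻¹ ≤ ‖z‖ ^ 5 * (1 / (3 : ℝ) ^ K)⁻¹ := by gcongr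
      _ = 1 / (3 : ℝ) ^ (4 * K) := by rw [hρ]; field_simp; ring
      _ ≤ 1 / (3 : ℝ) ^ N := third_pow_le hNK
  -- `L4/3^K − λ = (integer)/(12 b⁴)`
  have h12n : ‖(12 : ℚ_[3])⁻¹‖ = 3 := by
    have h3 : ‖(3 : ℚ_[3])⁻¹‖ = 3 := by
      rw [norm_inv, show (3 : ℚ_[3]) = ((3 : ℕ) : ℚ_[3]) by norm_cast, Padic.norm_p]; norm_num
    rw [show (12 : ℚ_[3]) = ((4 : ℤ) : ℚ_[3]) * 3 by norm_num, mul_inv, norm_mul, norm_inv,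
      norm_intCast_eq_one_of_not_dvd (by decide), inv_one, h3, one_mul]
  have h12 : (12 : ℚ_[3]) ≠ 0 := by norm_num
  have hid : L4 * P'⁻¹ - lam =
      ((((-12 * (a * e') * b ^ 3 + 6 * a₁ * 3 ^ K * (a * e') ^ 2 * b ^ 2 -
        4 * (a₁ ^ 2 + a₂) * 3 ^ (2 * K) * (a * e') ^ 3 * b +
        3 * (a₁ ^ 3 + 2 * a₁ * a₂ + 2 * a₃) * 3 ^ (3 * K) * (a * e') ^ 4 - 12 * lam * b ^ 4 : ℤ)) : ℚ_[3])) *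
        ((12 : ℚ_[3]) * (b : ℚ_[3]) ^ 4)⁻¹ := by
    rw [hL4, hzP, ha1, ha2, ha3, hP']
    push_cast
    field_simp
    ring
  have h2 : ‖L4 * P'⁻¹ - lam‖ ≤ 1 / (3 : ℝ) ^ N := by
    rw [hid, norm_mul, norm_inv, norm_mul, norm_pow, hbn, one_pow, mul_one, ← norm_inv, h12n]
    calc ‖((((-12 * (a * e') * b ^ 3 + 6 * a₁ * 3 ^ K * (a * e') ^ 2 * b ^ 2 -
          4 * (a₁ ^ 2 + a₂) * 3 ^ (2 * K) * (a * e') ^ 3 * b +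
          3 * (a₁ ^ 3 + 2 * a₁ * a₂ + 2 * a₃) * 3 ^ (3 * K) * (a * e') ^ 4 - 12 * lam * b ^ 4 : ℤ)) : ℚ_[3]))‖ * 3
          ≤ 1 / (3 : ℝ) ^ (N + 1) * 3 := by gcongr; exact norm_intCast_le_of_pow_dvd hlam
      _ = 1 / (3 : ℝ) ^ N := by rw [pow_succ]; field_simp
  refine ⟨?_, ?_⟩
  · have : L * P'⁻¹ - lam = (L - L4) * P'⁻¹ + (L4 * P'⁻¹ - lam) := by ring
    rw [this]; exact (IsUltrametricDist.norm_add_le_max _ _).trans (max_le h1 h2)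
  · -- `‖L‖ = ‖z‖` since `‖L − z‖ ≤ ‖z‖² < ‖z‖`
    have hLz : ‖L - z‖ ≤ ‖z‖ ^ 2 := norm_padicFormalLog_sub_self_le V hρ9
    have hρpos : 0 < ‖z‖ := by rw [hρ]; positivity
    rw [← hρ]
    refine Padic.norm_eq_of_norm_sub_lt_right (hLz.trans_lt ?_)
    calc ‖z‖ ^ 2 = ‖z‖ * ‖z‖ := sq _
      _ < ‖z‖ * 1 := by gcongr; exact hρ9.trans_lt (by norm_num)
      _ = ‖z‖ := mul_one _

end Summit.BirchSwinnertonDyer.Rank1Residual.X11b.RegMult.KernelCert
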